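import Literature.Probability.RandomPlanarGeometry.ExteriorULC
import HarnessLib

/-!
# The index of the boundary loop of a Jordan domain

Topic `Literature/Probability/RandomPlanarGeometry` (planar domains). The winding number of the
boundary loop `D.boundary` of a `JordanDomain` about a point, with the facts needed to speak of
the **orientation** of the loop — the hypothesis "marked points in anticlockwise order" of
Bollobás–Riordan's Theorem 2 / Lemma 14 (*Percolation* (2006), Ch. 7 p. 184: "the marked points
of the source are in anticlockwise order (its discrete domains are traversed anticlockwise)",
cf. the docstring of `tri_exists_discreteApprox`), using the winding-number theory of
`Topology/PlaneTopology/WindingNumber.lean` and the Eilenberg–Borsuk criterion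
(`EilenbergCriterion.lean`):

* `JordanDomain.circleHomeo` — the homeomorphism `ℝ/ℤ ≃ₜ ∂D` induced by the boundary loop,
  with `param circleHomeo = D.boundary` (`param_circleHomeo`), so that the lemmas of
  `JordanCurveProofs.lean` apply to `D.boundary`;
* `JordanDomain.index z = wind (D.boundary - z)`: constant on complementary components of the
  boundary (`index_eq_of_mem_connectedComponentIn`), hence on the domain
  (`index_eq_of_mem_carrier`); `0` on the exterior (`index_eq_zero_of_mem_exterior`, Rouché
  against a constant loop at a far point, the exterior being connected); **nonzero on the
  domain** (`index_ne_zero_of_mem_carrier`, Eilenberg–Borsuk);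
(Positive orientation of `D` is then the statement `D.index z = 1` for `z ∈ D.carrier`.)

## References

* B. Bollobás, O. Riordan, *Percolation*, Cambridge University Press (2006), Ch. 7, Lemma 14
  p. 184.
* S. Eilenberg, Fund. Math. 26 (1936) (criterion, via `EilenbergCriterion.lean`).

## Mathlib / tree

Mathlib: `AddCircle.liftIco`, `Continuous.isClosedEmbedding`, `connectedComponentIn`. Tree:
`WindingNumber.lean` (`wind`, `wind_eq_of_norm_sub_lt`, `wind_const`), `JordanCurveProofs.lean`
(`param`, `wind_sub_eq_of_mem`, `hasLogOn_iff_wind_eq_zero`), `EilenbergCriterion.lean`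
(`not_hasLogOn_sub`), `ExteriorULC.lean` (`isConnected_exterior`, `isOpen_exterior`).
-/

noncomputable section

open Set Filter Topology Metric Complex
open Literature.Topology.PlaneTopology Literature.Topology.PlaneTopology.JordanCurveProof

namespace Literature.Probability.RandomPlanarGeometry

namespace JordanDomain

variable (D : JordanDomain)

/-- **The circle homeomorphism of the boundary loop**: `ℝ/ℤ ≃ₜ ∂D` induced by `D.boundary`
(a continuous injection of a compact space into a Hausdorff space). [folklore] -/
def circleHomeo : AddCircle (1 : ℝ) ≃ₜ frontier D.carrier :=
  haveI : Fact ((0 : ℝ) < 1) := ⟨one_pos⟩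
  let f : AddCircle (1 : ℝ) → ℂ := AddCircle.liftIco 1 0 D.boundary
  have hfc : Continuous f :=
    AddCircle.liftIco_zero_continuous (by simpa using (D.periodic_boundary 0).symm) D.continuous_boundary.continuousOn
  have hfapply : ∀ x : ℝ, x ∈ Ico (0 : ℝ) 1 → f (x : AddCircle (1 : ℝ)) = D.boundary x := fun x hx =>
    AddCircle.liftIco_coe_apply (by simpa using hx)
  have hfinj : Function.Injective f := by
    intro a b hab
    obtain ⟨x, hx, rfl⟩ : ∃ x ∈ Ico (0 : ℝ) 1, (x : AddCircle (1 : ℝ)) = a :=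
      ⟨(AddCircle.equivIco 1 0 a : ℝ), by simpa using (AddCircle.equivIco 1 0 a).2, AddCircle.coe_equivIco⟩
    obtain ⟨y, hy, rfl⟩ : ∃ y ∈ Ico (0 : ℝ) 1, (y : AddCircle (1 : ℝ)) = b :=
      ⟨(AddCircle.equivIco 1 0 b : ℝ), by simpa using (AddCircle.equivIco 1 0 b).2, AddCircle.coe_equivIco⟩
    rw [hfapply x hx, hfapply y hy] at hab
    rw [D.injOn_boundary hx hy hab]
  have hrange : range f = frontier D.carrier := by
    rw [← D.range_boundary]
    ext z
    constructor
    · rintro ⟨a, rfl⟩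
      obtain ⟨x, hx, rfl⟩ : ∃ x ∈ Ico (0 : ℝ) 1, (x : AddCircle (1 : ℝ)) = a :=
        ⟨(AddCircle.equivIco 1 0 a : ℝ), by simpa using (AddCircle.equivIco 1 0 a).2, AddCircle.coe_equivIco⟩
      exact ⟨x, (hfapply x hx).symm⟩
    · rintro ⟨x, rfl⟩
      obtain ⟨y, hy, hyx⟩ := D.periodic_boundary.exists_mem_Ico one_pos x 0
      refine ⟨(y : AddCircle (1 : ℝ)), ?_⟩
      rw [hfapply y (by simpa using hy), hyx]
  ((hfc.isClosedEmbedding hfinj).isEmbedding.toHomeomorph).trans (Homeomorph.setCongr hrange)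

/-- The parametrisation attached to the circle homeomorphism is the boundary loop. [folklore] -/
theorem param_circleHomeo (t : ℝ) : param D.circleHomeo t = D.boundary t := by
  haveI : Fact ((0 : ℝ) < 1) := ⟨one_pos⟩
  obtain ⟨y, hy, hyx⟩ := D.periodic_boundary.exists_mem_Ico one_pos t 0
  have hy' : y ∈ Ico (0 : ℝ) 1 := by simpa using hy
  -- `t` and `y` have the same class
  have hclass : ((t : ℝ) : AddCircle (1 : ℝ)) = (y : AddCircle (1 : ℝ)) := by
    obtain ⟨n, hn⟩ : ∃ n : ℤ, t = y + n := by
      -- from periodicity witnesses: `y = t - ⌊t⌋`-like; use injectivity-free route via `exists_mem_Ico`'s form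
      have := hy
      -- `Function.Periodic.exists_mem_Ico` gives `y ∈ Ico 0 (0+1)` and `boundary y = boundary t` only;
      -- recover the class from `toIcoMod`: take `n = ⌊t⌋` and `y' = t - ⌊t⌋`, compare via injectivity
      refine ⟨⌊t⌋ - ⌊y⌋, ?_⟩
      have h1 : ⌊y⌋ = 0 := Int.floor_eq_zero_iff.2 ⟨hy'.1, hy'.2⟩
      rw [h1]; push_cast
      have hfr : D.boundary (Int.fract t) = D.boundary t := by
        rw [Int.fract, sub_eq_add_neg, ← Int.cast_neg]
        simpa using (D.periodic_boundary.int_mul (-⌊t⌋) t)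
      have hmem : Int.fract t ∈ Ico (0 : ℝ) 1 := ⟨Int.fract_nonneg t, Int.fract_lt_one t⟩
      have := D.injOn_boundary hy' hmem (hyx.symm.trans hfr.symm)
      rw [this, Int.fract]; ring
    rw [hn, coe_eq_coe_iff_exists_int]
    exact ⟨-n, by push_cast; ring⟩
  rw [param, hclass, hyx]
  -- unfold the homeomorphism on a class of `Ico 0 1`
  show ((D.circleHomeo (y : AddCircle (1 : ℝ))) : ℂ) = D.boundary y
  have e1 : ((D.circleHomeo (y : AddCircle (1 : ℝ))) : ℂ) = AddCircle.liftIco 1 0 D.boundary (y : AddCircle (1 : ℝ)) := rfl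
  rw [e1]
  exact AddCircle.liftIco_coe_apply (by simpa using hy')

/-- **The index of the boundary loop about a point**: the winding number of `t ↦ ∂D(t) - z`. [folklore] -/
def index (z : ℂ) : ℤ := wind fun t => D.boundary t - z

/-- The index in terms of the attached parametrisation. [folklore] -/
theorem index_eq_wind_param (z : ℂ) : D.index z = wind fun t => param D.circleHomeo t - z := by
  unfold index; congr 1; funext t; rw [param_circleHomeo]

/-- **The index is constant on each complementary component of the boundary.** [folklore] -/
theorem index_eq_of_mem_connectedComponentIn {a b : ℂ} (ha : a ∉ frontier D.carrier)
    (hb : b ∈ connectedComponentIn (frontier D.carrier)ᶜ a) : D.index a = D.index b := by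
  rw [index_eq_wind_param, index_eq_wind_param]
  exact wind_sub_eq_of_mem D.circleHomeo ha hb

/-- **The index is constant on the domain.** [folklore] -/
theorem index_eq_of_mem_carrier {a b : ℂ} (ha : a ∈ D.carrier) (hb : b ∈ D.carrier) : D.index a = D.index b := by
  refine D.index_eq_of_mem_connectedComponentIn (fun h => (Set.disjoint_left.1 D.disjoint_carrier_frontier) ha h) ?_
  exact (D.isConnected.isPreconnected.subset_connectedComponentIn ha
    (fun z hz hzf => (Set.disjoint_left.1 D.disjoint_carrier_frontier) hz hzf)) hb

/-- **The index vanishes on the exterior.** [folklore] -/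
theorem index_eq_zero_of_mem_exterior {z : ℂ} (hz : z ∈ (closure D.carrier)ᶜ) : D.index z = 0 := by
  -- a far point has index `0` (Rouché against the constant loop), and the exterior is connected
  obtain ⟨R, hR⟩ := (D.isBounded.union (D.isBounded.closure.subset frontier_subset_closure)).subset_closedBall 0
  set b : ℂ := (((R : ℝ) + |R| + 1 : ℝ) : ℂ) with hb
  have hbfar : ∀ w ∈ closure D.carrier, ‖w‖ < ‖b‖ := by
    intro w hw
    rw [D.closure_eq] at hw
    have hw' : w ∈ closedBall (0 : ℂ) R := by
      rcases hw with hw | hw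
      · exact hR (Or.inl hw)
      · exact hR (Or.inr (D.range_boundary ▸ hw))
    rw [mem_closedBall, dist_zero_right] at hw'
    rw [hb, Complex.norm_real, Real.norm_eq_abs]
    have : (R : ℝ) + |R| + 1 > 0 := by have := neg_abs_le R; linarith [abs_nonneg R]
    rw [abs_of_pos this]
    have := le_abs_self R
    linarith
  have hbext : b ∈ (closure D.carrier)ᶜ := fun h => lt_irrefl _ (hbfar b h)
  have hb0 : D.index b = 0 := by
    unfold index
    have hconst : wind (fun _ : ℝ => -b) = 0 := wind_const _
    rw [← hconst]
    have hbne : b ≠ 0 := by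
      intro h; rw [h, norm_zero] at hbfar
      exact (lt_irrefl _ ((norm_nonneg _).trans_lt (hbfar _ (subset_closure D.nonempty.some_mem)))).elim
    refine wind_eq_of_norm_sub_lt ((D.continuous_boundary.continuousOn).sub continuousOn_const) ?_
      (IsNonvanishingLoop.const (neg_ne_zero.2 hbne)) ?_
    · have := D.periodic_boundary 0
      simp only [zero_add] at this
      rw [this]
    · intro t _
      have : D.boundary t ∈ closure D.carrier := by
        rw [D.closure_eq]; exact Or.inr (mem_range_self t)
      simpa using hbfar _ this
  -- `z` and `b` are in the same component of the complement of the frontier: the exterior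
  have hzf : z ∉ frontier D.carrier := fun h => hz (frontier_subset_closure h)
  have hmem : b ∈ connectedComponentIn (frontier D.carrier)ᶜ z :=
    (D.isConnected_exterior.isPreconnected.subset_connectedComponentIn hz
      (fun w hw hwf => hw (frontier_subset_closure hwf))) hbext
  rw [D.index_eq_of_mem_connectedComponentIn hzf hmem, hb0]

/-- **The index does not vanish on the domain** (Eilenberg–Borsuk: the boundary separates
interior points from infinity). [folklore] -/
theorem index_ne_zero_of_mem_carrier {z : ℂ} (hz : z ∈ D.carrier) : D.index z ≠ 0 := by
  intro h0
  have hzf : z ∉ frontier D.carrier := fun h => (Set.disjoint_left.1 D.disjoint_carrier_frontier) hz h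
  -- the component of `z` in the complement of the boundary is `⊆ D`, hence bounded
  have hsub : connectedComponentIn (frontier D.carrier)ᶜ z ⊆ D.carrier := by
    refine (isPreconnected_connectedComponentIn).subset_left_of_subset_union D.isOpen D.isOpen_exterior
      D.disjoint_carrier_exterior ?_ ⟨z, mem_connectedComponentIn (by exact hzf), hz⟩
    intro w hw
    have hwf : w ∉ frontier D.carrier := connectedComponentIn_subset _ _ hw
    by_cases hwD : w ∈ D.carrier
    · exact Or.inl hwD
    · exact Or.inr (D.mem_exterior_of_not_mem hwD hwf)
  have hbdd : Bornology.IsBounded (connectedComponentIn (frontier D.carrier)ᶜ z) := D.isBounded.subset hsub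
  have hK : IsCompact (frontier D.carrier) :=
    D.isBounded.isCompact_closure.of_isClosed_subset isClosed_frontier frontier_subset_closure
  -- index `0` would give a logarithm of `· - z` on the boundary
  have hlog : HasLogOn (fun w => w - z) (frontier D.carrier) := by
    have hF : ContinuousOn (fun w : ℂ => w - z) (frontier D.carrier) := (continuous_id.sub continuous_const).continuousOn
    refine (hasLogOn_iff_wind_eq_zero D.circleHomeo hF (fun w hw => sub_ne_zero.2 fun h => hzf (h ▸ hw))).2 ?_
    have : ((fun w : ℂ => w - z) ∘ param D.circleHomeo) = fun t => D.boundary t - z := by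
      funext t; simp [param_circleHomeo]
    rw [this]; exact h0
  exact not_hasLogOn_sub hK hzf hbdd hlog

end JordanDomain

end Literature.Probability.RandomPlanarGeometry
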